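import Literature.NumberTheory.EllipticCurves.Rank1Residual.Typed.Basic
import Literature.NumberTheory.EllipticCurves.Rank1Residual.Typed.WuthrichUpperBound
import Literature.NumberTheory.EllipticCurves.Rank1Residual.X10Proofs
import Literature.NumberTheory.EllipticCurves.Rank1Residual.Typed.CasselsLowerBound
import HarnessLib

/-!
# Class X10 (`p = 3` good ordinary, `E[3]` irreducible, off the printed floor) — the residue X10b
# TYPED, and the whole class accounted (cell `b2b-bsdres`)

HONEST FRAMING (run/shared/lean/b2b/bsd-rank1-residual/, verbatim): the goal of the cell is to
DELETE the COMBINATION-SHAPED residual classes for ALL analytic-rank `≤ 1` elliptic curves over `ℚ`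
— "full BSD formula for every rank `≤ 1` curve in class C" assembled STRICTLY from published
theorems — so that the rank-`≤ 1` remainder becomes exactly the CONSTRUCTION-SHAPED classes, which
are TYPED (missing-input `Prop`s), NOT attempted. This is not "finishing BSD".

**The class.** X10 (RESIDUAL-CASES.md §a.2 v3; `Rank1Residual.ClassX10 W p :=
p = 3 ∧ GoodOrd W 3 ∧ Irr W 3 ∧ ((r = 0 ∧ ¬ Ram W 3) ∨ (r = 1 ∧ ¬ Semistable W))`). By the cell's
referee (REFEREE.md R6.1/R7.1) it splits EXACTLY on the census bit `surj(3)`: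
* X10a′ := X10 ∧ surj(3) — closed (PUB\*) by `Rank1Residual.bsdp_of_classX10_of_surj`
  (`X10Proofs.lean`): Yan–Zhu, J. Algebra 693 (2026) Thm. 4.15 (named fact) with (Im) witnessed by
  `3`-adic surjectivity (Wuthrich, Doc. Math. 19 (2014) Lemma 20, named fact), Gross–Zagier–Kolyvagin,
  modularity. Census `N < 10⁴`: 30 of 34 pairs (28 of analytic rank `1`, and `3136g1`, `8624b1`).
  Status flags of the Yan–Zhu input (X10-AUDIT.md §4, §8): `YZ26-BF-equiv` (Thm. 4.7 "as [BSTW]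
  (see also [CGS])", no proof printed), `YZ26@3-BF-ERL-Ohta` (at `p = 3` the Beilinson–Flach
  explicit reciprocity laws in Hida families behind Thm. 4.7 are in print only for `p ≥ 5` —
  Kings–Loeffler–Zerbes, Camb. J. Math. 5 (2017) §7.2: "We assume, for the remainder of this paper,
  that `p ≥ 5`"; Lei–Loeffler–Zerbes, Compos. Math. 151 (2015) §1.1 "`p ≥ 5`"; the `p = 3` case is
  asserted by Burungale–Skinner–Tian–Wan arXiv:2409.01350 Rem. 5.1 via the preprint of
  Sangiovanni Vincentelli–Skinner on Ohta's theorem, "with many cases already covered in Cais",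
  Compos. Math. 154 (2018)).
* X10b := X10 ∧ ¬surj(3) — census `1210k1`, `7442c1` (rank `1`), `1690i1`, `6050x1` (rank `0`) at
  `3` — on which the image hypothesis (Im)/(im) of EVERY published integral input is FALSE as a
  theorem of the tree (`Rank1Residual.ClassX10.not_bigIm_of_not_surj`, file `X9SmallImage.lean`:
  `irr(3) ∧ ¬surj(3)` ⇒ `3 ∤ #ρ̄_{E,3}(G_ℚ)` ⇒ no `τ` with `T₃E/(τ−1)T₃E ≅ ℤ₃`). X10b carries class
  X9's label (referee: CONSTRUCTION-SHAPED recommended, merged into X9 with `p ≥ 3`).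

**What kind of object is missing (X10b).** An INTEGRAL Iwasawa-theoretic input at a good ordinary
`p = 3` for an irreducible `E[3]` whose image has order prime to `3` (normaliser-of-Cartan type):
either the cyclotomic main conjecture in `Λ` (not `Λ ⊗ ℚ₃`) without an element of rank-one
cokernel, or a Kato/Kolyvagin-type bound without it — both directions; the rank-one branch also
needs the anticyclotomic (BDP / Heegner-point) main conjecture integrally without (sur)/(Im).

**Closest published results, verbatim, and why they do not reach X10b.**
* Yan–Zhu, J. Algebra 693 (2026) 372–402 = arXiv:2412.20078, Thm. 4.15 (§4.6): "Under any of the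
  above, if (Im) also holds, then `p`-part BSD formula for `E` holds", (Im) = "there exists
  `τ ∈ Gal(ℚ̄/ℚ(μ_{p^∞}))` such that `T_pE/(ρ_E(τ)−1)T_pE` is free of `ℤ_p`-rank one" — (Im) is false on
  X10b.
* Burungale–Castella–Skinner, IMRN (2025) Cor. 1.3.1: "Let `p > 3` be a prime of good ordinary
  reduction such that (irr_ℚ) and (im) hold" — `p > 3`, and (im) false on X10b.
* Kato, Astérisque 295 (2004) Thm. 17.4(3) via Thm. 13.4(3): "Assume that there exists an element `σ`
  of `Gal(ℚ̄/ℚ(ζ_{p^∞}))` such that `Coker(1 − σ : T → T)` is a free `O_L`-module of rank 1 … Assume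
  further `p ≠ 2`" — the element does not exist on X10b; only the `Λ ⊗ ℚ_p` divisibility remains.
* Skinner, Pacific J. Math. 283 (2016) Thm. C: needs "(ii) there exists a prime `q ≠ p` at which `E`
  has multiplicative reduction and `E[p]` is ramified" — such a `q` puts a transvection of order `3`
  in `ρ̄_{E,3}(G_ℚ)`, impossible when `3 ∤ #ρ̄_{E,3}(G_ℚ)`.
* Wuthrich, Doc. Math. 19 (2014) Prop. 21 (rank `0` upper bound `#Ш ∣ C·#Ш_an`): "where `C` is a
  rational number only divisible by `2`, primes of additive reduction or primes for which the Galois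
  representation on `E[p]` is neither surjective nor contained in a Borel subgroup" — X10b's prime `3`
  is exactly such a prime, so not even the Euler-system HALF (`Typed.MissingUpperBoundAt`) is in
  print on X10b (contrast `Typed/WuthrichUpperBound.lean` for the Borel-or-surjective classes).
* Announced only: Burungale–Skinner "[BS24]" (dihedral / small image; not on arXiv through
  2026-08-18, FRESHNESS.md §0); Burungale–Castella–Skinner 2025 Rem. 1.1.3(iii) "will be treated in
  [BS24]".

This file (definitions + bookkeeping theorems only; explicit binders; nothing asserted):
`X10.MissingInputAt W` := "off the published corner `surj(3)`, the whole output
`Typed.MissingPPartAt W 3`" (pattern of `Typed/X12.lean`), the conditional class theorems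
`X10.bsdp_three_of_missingInputAt` / `X10.bsdp_of_missingInputAt` (canonical shape
`r_an ≤ 1 → ClassX10 W p → X10.MissingInputAt W → BSDp W p`; on `surj(3)` the published corner is
used and the typed input is vacuous, `X10.missingInputAt_of_surj`), and the converse bookkeeping
`X10.missingInputAt_of_bsdp` (the typed input is not weaker than needed). The class-wide closed
statement "∀ (E,3) ∈ X10b, MissingPPartAt" is an OPEN PROBLEM and is not a Literature statement
(cell CLASSES.md only). Evidence file: HOME/X10-AUDIT.md (§5 X10b, §8 second-level audit).

References: X10-AUDIT.md; REFEREE.md R6.1, R7.1; Yan–Zhu 2026 [YanZhu2024MainConjNonCM];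
Wuthrich 2014 [Wuthrich2014]; Kato 2004 [Kato2004Asterisque]; Skinner 2016 [Skinner2016PacificMC];
Burungale–Castella–Skinner 2025 [BurungaleCastellaSkinner2025]; Miller 2011 [Miller2011LMS].
-/

noncomputable section

open scoped Classical

open WeierstrassCurve Literature.NumberTheory.EllipticCurves
  Literature.NumberTheory.EllipticCurves.Rank1Residual

namespace Literature.NumberTheory.EllipticCurves.Rank1Residual.Typed

/-- **X10 — the missing input at `(E, 3)`, typed.** On the published corner `surj(3)` (X10a′,
Yan–Zhu 2026 Thm. 4.15 + Wuthrich 2014 Lemma 20, `Rank1Residual.bsdp_of_classX10_of_surj`) nothing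
is missing; OFF it (X10b = X10 ∧ ¬surj(3): `E[3]` irreducible with `3 ∤ #ρ̄_{E,3}(G_ℚ)`, where the
image hypothesis (Im)/(im)/Kato's rank-one-cokernel element FAILS by
`Rank1Residual.ClassX10.not_bigIm_of_not_surj`, and where Wuthrich's Prop. 21 excludes the prime —
"neither surjective nor contained in a Borel subgroup") no published theorem delivers either half
of the `3`-part, so the missing input is the WHOLE output in Miller's currency,
`MissingPPartAt W 3` (`#Ш_an ∈ ℚ` with `ord_3 #Ш_an = ord_3 #Ш`), to be delivered by an integral
Iwasawa-theoretic (main-conj. / Euler-system) input for small irreducible images (announced: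
"[BS24]", not out).
A predicate on `W`; nothing asserted.
[cite: YanZhu2024MainConjNonCM, Thm. 4.15 (§4.6) and hypothesis (Im) (shape only; nothing asserted)] [cite: Wuthrich2014, Prop. 21 (p. 400), the constant C (shape only; nothing asserted)] [cite: Miller2011LMS, Def. 1.1 (shape only; nothing asserted)] -/
def X10.MissingInputAt (W : WeierstrassCurve ℚ) : Prop :=
  ¬ Surj W 3 → MissingPPartAt W 3

/-- On the published corner `surj(3)` (X10a′) the typed input is vacuous. Bookkeeping.
[cite: YanZhu2024MainConjNonCM, Thm. 4.15 (§4.6)] -/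
theorem X10.missingInputAt_of_surj (W : WeierstrassCurve ℚ) (hsurj : Surj W 3) :
    X10.MissingInputAt W :=
  fun hns => absurd hsurj hns

/-- Off the corner (X10b, `¬surj(3)`) the typed input IS the whole output `MissingPPartAt W 3` —
nothing narrower is in print there (Wuthrich's Prop. 21 excludes primes with image "neither
surjective nor contained in a Borel subgroup"). Bookkeeping. [cite: Wuthrich2014, Prop. 21 (p. 400)] -/
theorem X10.missingInputAt_iff_of_not_surj (W : WeierstrassCurve ℚ) (hns : ¬ Surj W 3) :
    X10.MissingInputAt W ↔ MissingPPartAt W 3 :=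
  ⟨fun h => h hns, fun h _ => h⟩

/-- **X10 conditional class theorem at `p = 3`.** For `E/ℚ` in class X10: on `surj(3)` Miller's
`BSD(E,3)` follows from the named facts Yan–Zhu 2026 Thm. 4.15 (`hYZ`; PUB\*, flags
`YZ26-BF-equiv`, `YZ26@3-BF-ERL-Ohta` — X10-AUDIT.md §8), Gross–Zagier–Kolyvagin (`hGZK`),
modularity (`hmod`) and Wuthrich 2014 Lemma 20 (`hW20`) through
`Rank1Residual.bsdp_of_classX10_of_surj`; on `¬surj(3)` (X10b) from the typed missing input. So
the whole class is accounted in the tree: PUB\* on X10a′, TYPED on X10b.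
[cite: YanZhu2024MainConjNonCM, Thm. 4.15 (§4.6)] [cite: Miller2011LMS, §1 and Def. 1.1] -/
theorem X10.bsdp_three_of_missingInputAt
    (hYZ : YanZhu2026.thm415_padicValRat_bsd_rank_le_one)
    (hGZK : rank_eq_analyticRank_of_analyticRank_le_one) (hmod : hasEntireLFunction_rat)
    (hW20 : Wuthrich2014.lemma20_surjective_threeAdic_of_semistable)
    (W : WeierstrassCurve ℚ) [W.IsElliptic] [W.IsGloballyMinimal]
    (hX : ClassX10 W 3) (hmiss : X10.MissingInputAt W) : BSDp W 3 := by
  by_cases hs : Surj W 3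
  · exact bsdp_of_classX10_of_surj hYZ hGZK hmod hW20 hX hs
  · exact bsdp_of_missingPPartAt W 3 hGZK hX.analyticRank_le_one (hmiss hs)

/-- **X10 conditional class theorem, canonical shape** (`r_an ≤ 1 → ClassX10 W p → typed input →
BSDp W p`; the class forces `p = 3` and `r_an ≤ 1`, so the rank hypothesis is carried only for
uniformity with the other `Typed/Xn` files). [cite: YanZhu2024MainConjNonCM, Thm. 4.15 (§4.6)] [cite: Miller2011LMS, §1 and Def. 1.1] -/
theorem X10.bsdp_of_missingInputAt
    (hYZ : YanZhu2026.thm415_padicValRat_bsd_rank_le_one)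
    (hGZK : rank_eq_analyticRank_of_analyticRank_le_one) (hmod : hasEntireLFunction_rat)
    (hW20 : Wuthrich2014.lemma20_surjective_threeAdic_of_semistable)
    (W : WeierstrassCurve ℚ) [W.IsElliptic] [W.IsGloballyMinimal] (p : ℕ) [Fact p.Prime]
    (_hr : W.analyticRank ≤ 1) (hX : ClassX10 W p) (hmiss : X10.MissingInputAt W) : BSDp W p := by
  have hp : p = 3 := hX.1
  subst hp
  exact X10.bsdp_three_of_missingInputAt hYZ hGZK hmod hW20 W hX hmiss

/-- The typed input is not weaker than needed: `BSD(E,3)` (with `Ш` finite) gives it back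
(`Typed.missingPPartAt_of_bsdp`). Bookkeeping. [cite: Miller2011LMS, Def. 1.1] -/
theorem X10.missingInputAt_of_bsdp (W : WeierstrassCurve ℚ) [Finite W.sha] (h : BSDp W 3) :
    X10.MissingInputAt W :=
  fun _ => missingPPartAt_of_bsdp W 3 h

/-- **The X10 trichotomy of evidence, in one statement.** For `E/ℚ` in class X10, granted the four
named facts: `surj(3)` ⇒ `BSD(E,3)` (published corner); `¬surj(3)` ⇒ the image hypothesis (Im) of
every published integral input fails at `(E,3)` (kernel theorem, unconditional) AND `BSD(E,3)`
follows from — and, `Ш` being finite by GZK, is equivalent to — the typed missing input. Nothing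
here claims `BSD(E,3)` on X10b. [cite: YanZhu2024MainConjNonCM, Thm. 4.15 (§4.6), hypothesis (Im)] [cite: Miller2011LMS, Def. 1.1] -/
theorem X10.accounted
    (hYZ : YanZhu2026.thm415_padicValRat_bsd_rank_le_one)
    (hGZK : rank_eq_analyticRank_of_analyticRank_le_one) (hmod : hasEntireLFunction_rat)
    (hW20 : Wuthrich2014.lemma20_surjective_threeAdic_of_semistable)
    (W : WeierstrassCurve ℚ) [W.IsElliptic] [W.IsGloballyMinimal] (hX : ClassX10 W 3) :
    (Surj W 3 → BSDp W 3) ∧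
      (¬ Surj W 3 → ¬ BigIm W 3 ∧ (MissingPPartAt W 3 ↔ BSDp W 3)) := by
  refine ⟨fun hs => bsdp_of_classX10_of_surj hYZ hGZK hmod hW20 hX hs, fun hns => ⟨?_, ?_⟩⟩
  · exact ClassX10.not_bigIm_of_not_surj W 3 hX hns
  · haveI : Finite W.sha := (hGZK W hX.analyticRank_le_one).2
    exact ⟨fun h => bsdp_of_missingPPartAt W 3 hGZK hX.analyticRank_le_one h,
      fun h => missingPPartAt_of_bsdp W 3 h⟩

/-! ### Appendix (2026-08-18, X10-AUDIT.md §8): what X10 ∧ r = 0 ∧ surj(3) retains from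
PUBLISHED inputs alone — i.e. WITHOUT the Yan–Zhu fact, whose `p = 3` proof invokes Beilinson–Flach
reciprocity laws printed only for `p ≥ 5` (flag `YZ26@3-BF-ERL-Ohta`). On the rank-`0` branch of X10a′
the Euler-system HALF is in print (Wuthrich, Doc. Math. 19 (2014) Prop. 21: odd `p`, not additive at
`p`, image surjective-or-Borel — `surj(3)` here; named fact `Wuthrich2014.sha_dvd_analyticSha`), so
without Yan–Zhu the missing piece there is exactly the LOWER bound `Typed.MissingLowerBoundAt W 3`
(the Skinner–Urban / Beilinson–Flach side), and the per-curve lever "`3 ∤ #Ш_an`" closes `BSD(E,3)`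
outright (census `N < 10⁴`: `3136g1@3`, `8624b1@3`, both `#Ш_an = 1`). Nothing here is new
mathematics: instances of `Typed/WuthrichUpperBound.lean` and `Wuthrich2014/ShaBoundProofs.lean` on
the predicate `ClassX10`. -/

/-- **X10 ∧ r = 0 ∧ surj(3): the upper-bound half is PUBLISHED** (Wuthrich 2014 Prop. 21, `hW`;
GZK `hGZK`; modularity `hmod` to read `r_an = 0` as `L(E,1) ≠ 0`): `ord_3 #Ш ≤ ord_3 #Ш_an`. The class
supplies "not additive at `3`" (good reduction) and the image alternative (`surj(3)`).
[cite: Wuthrich2014, Prop. 21 (p. 400)] [cite: Miller2011LMS, §1] -/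
theorem X10.missingUpperBoundAt_rankZero_of_surj (hW : Wuthrich2014.sha_dvd_analyticSha)
    (hGZK : rank_eq_analyticRank_of_analyticRank_le_one) (hmod : hasEntireLFunction_rat)
    (W : WeierstrassCurve ℚ) [W.IsElliptic] [W.IsGloballyMinimal]
    (hX : ClassX10 W 3) (hr0 : W.analyticRank = 0) (hsurj : Surj W 3) :
    MissingUpperBoundAt W 3 :=
  missingUpperBoundAt_of_wuthrich W 3 hW hGZK hmod (by decide) hr0
    (WeierstrassCurve.HasGoodReduction.not_hasAdditiveReduction _ hX.2.1.1) (Or.inr hsurj)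

/-- **X10 ∧ r = 0 ∧ surj(3) WITHOUT Yan–Zhu: the missing input is the LOWER bound alone.**
Granted Wuthrich's Prop. 21 (`hW`), GZK and modularity — all published — `BSD(E,3)` follows from
`Typed.MissingLowerBoundAt W 3` (`ord_3 #Ш_an ≤ ord_3 #Ш`: the main-conj. direction, which at `p = 3`
is where X10-AUDIT §8 row Y6 locates the preprint-only input). Bookkeeping instance of
`Typed.bsdp_of_missingLowerBoundAt_of_wuthrich`. [cite: Wuthrich2014, Prop. 21 (p. 400)] [cite: Miller2011LMS, §1 and Def. 1.1] -/
theorem X10.bsdp_three_rankZero_surj_of_missingLowerBoundAt (hW : Wuthrich2014.sha_dvd_analyticSha)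
    (hGZK : rank_eq_analyticRank_of_analyticRank_le_one) (hmod : hasEntireLFunction_rat)
    (W : WeierstrassCurve ℚ) [W.IsElliptic] [W.IsGloballyMinimal]
    (hX : ClassX10 W 3) (hr0 : W.analyticRank = 0) (hsurj : Surj W 3)
    (hlow : MissingLowerBoundAt W 3) : BSDp W 3 :=
  bsdp_of_missingLowerBoundAt_of_wuthrich W 3 hW hGZK hmod (by decide) hr0
    (WeierstrassCurve.HasGoodReduction.not_hasAdditiveReduction _ hX.2.1.1) (Or.inr hsurj) hlow

/-- **Per-curve lever L1 on X10 (PUBLISHED inputs only): X10 ∧ r = 0 ∧ surj(3) ∧ `ord_3 #Ш_an = 0`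
⇒ `BSD(E,3)`** — Wuthrich 2014 Prop. 21 (`hW`) with GZK and modularity, through
`Wuthrich2014.bsdp_of_L_one_ne_zero_of_padicValRat_shaAn_eq_zero`: `0 ≤ ord_3 #Ш ≤ ord_3 #Ш_an = 0`.
Census `N < 10⁴`: the two rank-`0` pairs of X10a′, `3136g1@3` and `8624b1@3` (`#Ш_an = 1`), are thus
closed independently of the Yan–Zhu input. [cite: Wuthrich2014, Prop. 21 (p. 400)] [cite: Miller2011LMS, Def. 1.1] -/
theorem X10.bsdp_three_rankZero_surj_of_shaAn_unit (hW : Wuthrich2014.sha_dvd_analyticSha)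
    (hGZK : rank_eq_analyticRank_of_analyticRank_le_one) (hmod : hasEntireLFunction_rat)
    (W : WeierstrassCurve ℚ) [W.IsElliptic] [W.IsGloballyMinimal]
    (hX : ClassX10 W 3) (hr0 : W.analyticRank = 0) (hsurj : Surj W 3)
    (hunit : ∃ q : ℚ, shaAn W = (q : ℂ) ∧ padicValRat 3 q = 0) : BSDp W 3 :=
  Wuthrich2014.bsdp_of_L_one_ne_zero_of_padicValRat_shaAn_eq_zero hW hGZK W 3 (by decide)
    ((W.analyticRank_eq_zero_iff_holds (hmod W)).mp hr0)
    (WeierstrassCurve.HasGoodReduction.not_hasAdditiveReduction _ hX.2.1.1) (Or.inr hsurj) hunit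

/-! ### Appendix 2 (2026-08-18, X10-AUDIT.md §9.8): X10 ∧ r = 0 ∧ surj(3) with `ord_3 #Ш_an = 2` —
`BSD(E,3)` from PUBLISHED theorems plus ONE finite certificate `3 ∣ #Ш(E/ℚ)`, WITHOUT Yan–Zhu
(Wuthrich 2014 Prop. 21 upper bound `ord_3 #Ш ≤ 2`; Cassels–Tate: `#Ш` is a square, so `Ш(E)[3] ≠ 0`
forces `#Ш[3^∞] = 9`). Instance of x11b-g3's `Typed.bsdp_of_wuthrich_of_casselsTate_of_dvd`
(`Typed/CasselsLowerBound.lean`) on the predicate `ClassX10` — the rank-zero analogue for X10 of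
`X11ThreeRankZero.bsdp_of_casselsTate_of_three_dvd` (referee R9.3: "PUB modulo per-curve certificate
`Ш(E)[3] ≠ 0` (3-descent)"). Census (`N < 2·10⁴`, 19:14:57Z collector): the four rank-`0` X10a′ pairs with
`#Ш_an = 9` — `9800i1@3`, `15376i1@3`, `15376k1@3`, `15488h1@3` — listed in RESIDUAL-CASES §a.2 as
reachable "ONLY by C16"; the other 12 rank-`0` X10a′ pairs have `#Ш_an = 1` (lever L1 above). -/

/-- **X10 ∧ r = 0 ∧ surj(3) ∧ `ord_3 #Ш_an ≤ 2` ∧ `3 ∣ #Ш(E/ℚ)` ⇒ `BSD(E,3)`** (published inputs: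
Wuthrich 2014 Prop. 21 `hW`, Cassels–Tate squareness `hCT`, Gross–Zagier–Kolyvagin `hGZK`, modularity
`hmod`; per-curve certificates: `#Ш_an = q` with `ord_3 q ≤ 2`, and `3 ∣ #Ш(E/ℚ)` — e.g. a `3`-descent
showing `Sel^{(3)}(E/ℚ) ≠ 0` for a rank-`0` curve with `E(ℚ)[3] = 0`). No Yan–Zhu / Beilinson–Flach
input. [cite: Wuthrich2014, Prop. 21 (p. 400)] [cite: SilvermanAEC2009, Thm. X.4.14]
[cite: Miller2011LMS, §1 and Def. 1.1] -/
theorem X10.bsdp_three_rankZero_surj_of_casselsTate_of_three_dvd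
    (hCT : exists_casselsTate_pairing (K := ℚ)) (hW : Wuthrich2014.sha_dvd_analyticSha)
    (hGZK : rank_eq_analyticRank_of_analyticRank_le_one) (hmod : hasEntireLFunction_rat)
    (W : WeierstrassCurve ℚ) [W.IsElliptic] [W.IsGloballyMinimal]
    (hX : ClassX10 W 3) (hr0 : W.analyticRank = 0) (hsurj : Surj W 3)
    {q : ℚ} (hq : shaAn W = (q : ℂ)) (hv : padicValRat 3 q ≤ 2) (hdvd : 3 ∣ W.shaOrder) :
    BSDp W 3 :=
  bsdp_of_wuthrich_of_casselsTate_of_dvd W 3 hCT hW hGZK hmod (by decide) hr0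
    (WeierstrassCurve.HasGoodReduction.not_hasAdditiveReduction _ hX.2.1.1) (Or.inr hsurj) hq hv hdvd

end Literature.NumberTheory.EllipticCurves.Rank1Residual.Typed
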